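import Literature.AlgebraicGeometry.HodgeTheory.FermatSurfaceModelCharts
import Literature.AlgebraicGeometry.HodgeTheory.FermatSurfaceModelFibres
import Literature.Analysis.Complex.RotationEigenfunctionOrder
import HarnessLib

/-!
# Holomorphic models of the Fermat surface: the invariant quotient function read on a line of the `u`-plane is holomorphic at the generic points

Family `hodge`, layer `Literature/AlgebraicGeometry/HodgeTheory`. PROOF FILE (theorems only; no
definition, no named fact — D-0026), continuing `FermatSurfaceModelFibres` /
`FermatSurfaceModelCharts`. For a holomorphic model `(ψ, Φ)` of the Fermat surface, a function
`f₀` complex differentiable on `M₀` and its quotient `F = f₀ / ∏_r y_r^{⟨β_r⟩−1}`, constant on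
the fibres of `x ↦ (y_r(x)ᵐ)_r` (`fermatQuotientFn_eq_of_pow_eq`), the **line function** of the
line `u₂ = λ u₁ + μ` of the affine `u`-plane (`u_r = y_rᵐ`) is any `G : ℂ → ℂ` with
`G t = F x` whenever `x ∈ M₀` has no vanishing coordinate, `y₁(x)ᵐ = t` and
`y₂(x)ᵐ = λ t + μ` (well defined by the fibre constancy). Proved here:

* `exists_analyticAt_pow_eq_linear` — a holomorphic branch `r(s)ᵐ = A s + B` at `s = 0`
  (`B ≠ 0`), the one-variable input;
* `differentiableAt_fermatQuotientFn_comp` — `F ∘ Γ` is complex differentiable at `t₀` for a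
  curve `Γ` differentiable at `t₀` through a point of `M₀` with no vanishing coordinate;
* `differentiableAt_lineFunction` — **`G` is complex differentiable at every `t₀` with
  `t₀ ≠ 0`, `λ t₀ + μ ≠ 0`, `1 + t₀ + λ t₀ + μ ≠ 0`**: near `t₀`, `G = F ∘ Γ` for the lifted
  curve `Γ` with `y₁(Γ t)ᵐ = t`, `y₂(Γ t)ᵐ = λ t + μ` through a point over `t₀`
  (`exists_coordChart`, `exists_liftedCurve` with the branches `r₁(t)ᵐ = t`, `r₂(t)ᵐ = λt + μ`).

## References

* [Shioda1979HodgeFermat] T. Shioda, The Hodge conjecture for Fermat varieties, Math. Ann. 245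
  (1979) 175–184, §1.
* [GriffithsHarris1978] P. Griffiths, J. Harris, Principles of Algebraic Geometry (1978), Ch. 0
  §1.
-/

noncomputable section

open scoped Manifold ContDiff Topology LinearAlgebra.Projectivization
open Set Filter Projectivization Function

namespace Literature.AlgebraicGeometry.HodgeTheory

open Literature.AlgebraicGeometry.Motives Literature.NumberTheory.Transcendental
  Literature.Geometry.Kaehler Literature.Analysis.Complex

/-! ### A holomorphic branch of `(A s + B)^{1/m}` -/

/-- **A holomorphic branch of `(A s + B)^{1/m}` at `0`**: for `m ≠ 0` and `c₀ᵐ = B ≠ 0` the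
function `r(s) = c₀ · (1 + A s / B)^{1/m}` (principal branch) is analytic at `0`, `r(0) = c₀` and
`r(s)ᵐ = A s + B` for every `s`. [folklore] -/
theorem exists_analyticAt_pow_eq_linear {m : ℕ} (hm : m ≠ 0) (A : ℂ) {B c₀ : ℂ} (hB : B ≠ 0)
    (hc₀ : c₀ ^ m = B) :
    ∃ r : ℂ → ℂ, AnalyticAt ℂ r 0 ∧ r 0 = c₀ ∧ ∀ s, r s ^ m = A * s + B := by
  set r : ℂ → ℂ := fun s ↦ c₀ * (1 + A * s / B) ^ ((m : ℂ)⁻¹) with hrdef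
  refine ⟨r, ?_, ?_, ?_⟩
  · have h1 : AnalyticAt ℂ (fun s : ℂ ↦ 1 + A * s / B) 0 :=
      analyticAt_const.add ((analyticAt_const.mul analyticAt_id).div analyticAt_const hB)
    have hslit : (fun s : ℂ ↦ 1 + A * s / B) 0 ∈ Complex.slitPlane := by
      simp [Complex.one_mem_slitPlane]
    exact analyticAt_const.mul (h1.cpow analyticAt_const hslit)
  · simp [hrdef]
  · intro s
    simp only [hrdef, mul_pow, Complex.cpow_nat_inv_pow _ hm, hc₀]
    field_simp
    ring

section Surface

variable {m : ℕ} {E : Type*} [NormedAddCommGroup E] [NormedSpace ℂ E] [FiniteDimensional ℂ E]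
  {M : Type*} [TopologicalSpace M] [ChartedSpace E M] [IsManifold 𝓘(ℂ, E) ω M]
  {ψ : M → ℙ ℂ (Fin (2 + 2) → ℂ)} {Φ : fermatGroup 2 m → M → M}

/-! ### `F ∘ Γ` is differentiable -/

omit [FiniteDimensional ℂ E] [IsManifold 𝓘(ℂ, E) ω M] in
/-- **`F ∘ Γ` is complex differentiable** at `t₀`, for `F = f₀ / ∏_r y_r^{c_r}`, `f₀` complex
differentiable at `Γ t₀ ∈ M₀`, all `y_r(Γ t₀) ≠ 0`, and `Γ` complex differentiable at `t₀`
(chain rule, then the one-variable quotient rule). [folklore] -/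
theorem differentiableAt_fermatQuotientFn_comp (hψ : Continuous ψ) (hhol : HasHolomorphicCoords E ψ)
    {f₀ : M → ℂ} {c : Fin (2 + 2) → ℕ} {Fq : M → ℂ}
    (hFq : ∀ x, Fq x = f₀ x / ∏ r, projLift ψ 0 x r ^ c r) {Γ : ℂ → M} {t₀ : ℂ}
    (hΓ : MDifferentiableAt 𝓘(ℂ, ℂ) 𝓘(ℂ, E) Γ t₀) (hx : Γ t₀ ∈ liftDomain ψ 0)
    (hf₀ : MDifferentiableAt 𝓘(ℂ, E) 𝓘(ℂ, ℂ) f₀ (Γ t₀)) (hne : ∀ r, projLift ψ 0 (Γ t₀) r ≠ 0) :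
    DifferentiableAt ℂ (fun t ↦ Fq (Γ t)) t₀ := by
  have hfun : (fun t ↦ Fq (Γ t)) = fun t ↦ f₀ (Γ t) / ∏ r, projLift ψ 0 (Γ t) r ^ c r := by
    funext t; rw [hFq]
  rw [hfun]
  have h1 : DifferentiableAt ℂ (fun t ↦ f₀ (Γ t)) t₀ :=
    mdifferentiableAt_iff_differentiableAt.mp (hf₀.comp t₀ hΓ)
  have hy : ∀ r, DifferentiableAt ℂ (fun t ↦ projLift ψ 0 (Γ t) r) t₀ := by
    intro r
    have hg : MDifferentiableAt 𝓘(ℂ, E) 𝓘(ℂ, Fin (2 + 2) → ℂ) (projLift ψ 0) (Γ t₀) :=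
      (mdifferentiableOn_projLift ψ hhol 0 _ hx).mdifferentiableAt
        ((isOpen_liftDomain ψ hψ 0).mem_nhds hx)
    have h := mdifferentiableAt_iff_differentiableAt.mp (hg.comp t₀ hΓ)
    exact differentiableAt_pi.1 h r
  have h2 : DifferentiableAt ℂ (fun t ↦ ∏ r, projLift ψ 0 (Γ t) r ^ c r) t₀ := by
    have : (fun t ↦ ∏ r, projLift ψ 0 (Γ t) r ^ c r) =
        ∏ r, (fun t ↦ projLift ψ 0 (Γ t) r ^ c r) := by
      funext t; simp [Finset.prod_apply]
    rw [this]
    exact DifferentiableAt.finsetProd fun r _ ↦ (hy r).pow _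
  exact h1.div h2 (Finset.prod_ne_zero_iff.mpr fun r _ ↦ pow_ne_zero _ (hne r))

/-! ### Points over the generic points of the line -/

omit [FiniteDimensional ℂ E] [TopologicalSpace M] [ChartedSpace E M] [IsManifold 𝓘(ℂ, E) ω M] in
/-- **Over every generic point of the line there is a point of `M₀` with no vanishing
coordinate**: for `t ≠ 0`, `λ t + μ ≠ 0`, `1 + t + λ t + μ ≠ 0`, with `m`-th roots
`ρ₁, ρ₂, ρ₃` of `t, λ t + μ, −(1 + t + λ t + μ)`, the normalised solution `(1, ρ₁, ρ₂, ρ₃)` is a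
lift `Z̃₀ x` (`exists_projLift_eq`). [cite: Shioda1979HodgeFermat, §1] -/
theorem exists_point_over_line [NeZero m] (hrange : Set.range ψ = projZeroLocus {fermatPolynomial ℂ 2 m})
    (lam mu : ℂ) {t : ℂ} (ht₀ : t ≠ 0) (ht₁ : lam * t + mu ≠ 0) (ht₂ : 1 + t + (lam * t + mu) ≠ 0) :
    ∃ x, x ∈ liftDomain ψ 0 ∧ (∀ r, projLift ψ 0 x r ≠ 0) ∧ projLift ψ 0 x 1 ^ m = t ∧
      projLift ψ 0 x 2 ^ m = lam * t + mu := by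
  have hm : m ≠ 0 := NeZero.ne m
  have hmpos : 0 < m := Nat.pos_of_ne_zero hm
  obtain ⟨ρ₁, hρ₁⟩ := IsAlgClosed.exists_pow_nat_eq t hmpos
  obtain ⟨ρ₂, hρ₂⟩ := IsAlgClosed.exists_pow_nat_eq (lam * t + mu) hmpos
  obtain ⟨ρ₃, hρ₃⟩ := IsAlgClosed.exists_pow_nat_eq (-(1 + t + (lam * t + mu))) hmpos
  have hρ₁0 : ρ₁ ≠ 0 := by rintro rfl; rw [zero_pow hm] at hρ₁; exact ht₀ hρ₁.symm
  have hρ₂0 : ρ₂ ≠ 0 := by rintro rfl; rw [zero_pow hm] at hρ₂; exact ht₁ hρ₂.symm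
  have hρ₃0 : ρ₃ ≠ 0 := by
    rintro rfl; rw [zero_pow hm] at hρ₃; exact ht₂ (neg_eq_zero.mp hρ₃.symm)
  set v : Fin (2 + 2) → ℂ := ![1, ρ₁, ρ₂, ρ₃] with hv
  have hvsum : ∑ r, v r ^ m = 0 := by
    rw [Fin.sum_univ_four]
    simp only [hv, Matrix.cons_val_zero, Matrix.cons_val_one, Matrix.cons_val, one_pow, hρ₁, hρ₂,
      hρ₃]
    ring
  obtain ⟨x₀, hx₀, hx₀v⟩ := exists_projLift_eq hrange (k := 0) (v := v) rfl hvsum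
  refine ⟨x₀, hx₀, fun r ↦ ?_, ?_, ?_⟩
  · rw [hx₀v]
    fin_cases r
    · simp [hv]
    · exact hρ₁0
    · exact hρ₂0
    · exact hρ₃0
  · rw [hx₀v]; exact hρ₁
  · rw [hx₀v]; exact hρ₂

/-! ### The line function is holomorphic at the generic points -/

/-- **The line function of `u₂ = λ u₁ + μ` is complex differentiable at every generic `t₀`**
(`t₀ ≠ 0`, `λ t₀ + μ ≠ 0`, `1 + t₀ + λ t₀ + μ ≠ 0`). Through a point `x₀ ∈ M₀` over `t₀` with no
vanishing coordinate (`exists_point_over_line`) the coordinates `(y₁, y₂)` are a holomorphic chart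
(`exists_coordChart`, `y₃(x₀) ≠ 0`), and the lifted curve `Γ` with `y₁(Γ t) = r₁ t`,
`y₂(Γ t) = r₂ t` (`r₁ᵐ = t`, `r₂ᵐ = λ t + μ`, `exists_analyticAt_pow_eq_linear`) lies over the
line, so `G = F ∘ Γ` near `t₀`, which is differentiable (`differentiableAt_fermatQuotientFn_comp`).
[cite: Shioda1979HodgeFermat, §1] [cite: GriffithsHarris1978, Ch. 0 §1] -/
theorem differentiableAt_lineFunction [NeZero m] (hψ : Topology.IsEmbedding ψ)
    (hrange : Set.range ψ = projZeroLocus {fermatPolynomial ℂ 2 m}) (hhol : HasHolomorphicCoords E ψ)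
    (h2 : Module.finrank ℂ E = 2) {f₀ : M → ℂ}
    (hf₀d : ∀ x ∈ liftDomain ψ 0, MDifferentiableAt 𝓘(ℂ, E) 𝓘(ℂ, ℂ) f₀ x)
    {c : Fin (2 + 2) → ℕ} {Fq : M → ℂ} (hFq : ∀ x, Fq x = f₀ x / ∏ r, projLift ψ 0 x r ^ c r)
    (lam mu : ℂ) {G : ℂ → ℂ}
    (hG : ∀ (t : ℂ) (x : M), x ∈ liftDomain ψ 0 → (∀ r, projLift ψ 0 x r ≠ 0) →
      projLift ψ 0 x 1 ^ m = t → projLift ψ 0 x 2 ^ m = lam * t + mu → G t = Fq x)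
    {t₀ : ℂ} (ht₀ : t₀ ≠ 0) (ht₁ : lam * t₀ + mu ≠ 0) (ht₂ : 1 + t₀ + (lam * t₀ + mu) ≠ 0) :
    DifferentiableAt ℂ G t₀ := by
  have hm : m ≠ 0 := NeZero.ne m
  have hψc := hψ.continuous
  -- the point `x₀` over `t₀`
  obtain ⟨x₀, hx₀, hne, hy1m, hy2m⟩ := exists_point_over_line (ψ := ψ) hrange lam mu ht₀ ht₁ ht₂
  -- the chart `(y₁, y₂)` at `x₀`
  obtain ⟨e, hx₀e, hesrc, -, hesymm, he1⟩ := exists_coordChart (k := 0) (i := 1) (j := 2) (l := 3)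
    hψ hrange.le hhol h2 (fun r ↦ by fin_cases r <;> simp) hx₀ (hne 3)
  -- the branches `r₁ᵐ = t`, `r₂ᵐ = λ t + μ` at `t₀`
  obtain ⟨q₁, hq₁an, hq₁0, hq₁pow⟩ := exists_analyticAt_pow_eq_linear hm 1 ht₀ hy1m
  obtain ⟨q₂, hq₂an, hq₂0, hq₂pow⟩ := exists_analyticAt_pow_eq_linear hm lam ht₁ hy2m
  set r₁ : ℂ → ℂ := fun t ↦ q₁ (t - t₀) with hr₁
  set r₂ : ℂ → ℂ := fun t ↦ q₂ (t - t₀) with hr₂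
  have hshift : AnalyticAt ℂ (fun t : ℂ ↦ t - t₀) t₀ := analyticAt_id.sub analyticAt_const
  have hr₁an : AnalyticAt ℂ r₁ t₀ := hq₁an.comp_of_eq hshift (by simp)
  have hr₂an : AnalyticAt ℂ r₂ t₀ := hq₂an.comp_of_eq hshift (by simp)
  have hr₁pow : ∀ t, r₁ t ^ m = t := fun t ↦ by
    simp only [hr₁]; rw [hq₁pow]; ring
  have hr₂pow : ∀ t, r₂ t ^ m = lam * t + mu := fun t ↦ by
    simp only [hr₂]; rw [hq₂pow]; ring
  have hr₁0 : r₁ t₀ = projLift ψ 0 x₀ 1 := by simp only [hr₁]; rw [sub_self, hq₁0]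
  have hr₂0 : r₂ t₀ = projLift ψ 0 x₀ 2 := by simp only [hr₂]; rw [sub_self, hq₂0]
  -- the lifted curve
  obtain ⟨Γ, hΓ0, hΓd0, hΓev⟩ := exists_liftedCurve (ψ := ψ) e hx₀e hesymm he1 hr₁an hr₂an hr₁0 hr₂0
  -- non-vanishing of `r₁, r₂` near `t₀`
  have hr₁ne : ∀ᶠ t in 𝓝 t₀, r₁ t ≠ 0 := hr₁an.continuousAt.eventually_ne (by rw [hr₁0]; exact hne 1)
  have hr₂ne : ∀ᶠ t in 𝓝 t₀, r₂ t ≠ 0 := hr₂an.continuousAt.eventually_ne (by rw [hr₂0]; exact hne 2)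
  -- `G = F ∘ Γ` near `t₀`
  have hGΓ : ∀ᶠ t in 𝓝 t₀, G t = Fq (Γ t) := by
    filter_upwards [hΓev, hr₁ne, hr₂ne] with t ht h1 h2'
    obtain ⟨hsrc, -, hyi, hyj⟩ := ht
    have hΓt := hesrc hsrc
    refine hG t (Γ t) hΓt.1 (fun r ↦ ?_) (by rw [hyi, hr₁pow]) (by rw [hyj, hr₂pow])
    fin_cases r
    · exact (projLift_apply_self ψ 0 (Γ t)).symm ▸ one_ne_zero
    · change projLift ψ 0 (Γ t) 1 ≠ 0; rw [hyi]; exact h1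
    · change projLift ψ 0 (Γ t) 2 ≠ 0; rw [hyj]; exact h2'
    · exact hΓt.2
  have hdiff := differentiableAt_fermatQuotientFn_comp hψc hhol hFq hΓd0 (hΓ0 ▸ hx₀)
    (hf₀d _ (hΓ0 ▸ hx₀)) (fun r ↦ by rw [hΓ0]; exact hne r)
  exact hdiff.congr_of_eventuallyEq hGΓ

end Surface

end Literature.AlgebraicGeometry.HodgeTheory

end
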